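import Summits.QuantumFields.YangMills.Theorems.BalabanUVNodesSpineRatesHolder
import Summits.QuantumFields.YangMills.Theorems.BalabanUVNodesRateReadingOfRecord13CoPH
import Summits.QuantumFields.YangMills.Theorems.BalabanUVNodesN16AtRRec13CoPHLines
import Summits.QuantumFields.YangMills.Theorems.BalabanUVNodesN16H5OfPSlot
import Summits.QuantumFields.YangMills.Theorems.BalabanUVNodesN16H7LooseOfThm1At

/-!
# Route «BalabanUVNodes», crux K3⁷ `SpineGivenEndpointR13SepCoPH` (stmt-QuantumFields-20544) — node N16 = NE3: THE N16 PIN OF A STAGE-13 RATE READING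
# (`N16PinnedConst 𝔯 ℓ₃` = all data of record ∣ `N16PinnedLoose 𝔯 ℓ₃ B` = print's (7)-ball), THE END's LETTER ROWS `N16LettersEnd`, THE N16 CONJUNCT AT A READING
# `N16HolderAtReading 𝔯 β`, THE NE3-ERASED READING `eraseNE3 𝔯` (the vacuity witness), AND THE BY-NAME PRODUCERS UNDER EACH PIN

Cell `pub-ymgap`, seat `pub-ymgap-dag-n16-e` (R134 acceleration seat (a), strategy s2 = BY-NAME KNIT at the record; HUMAN RULING D-0062; chair R424 venue), generation 16,
module 43 (DEFINITION LANE: 5 `def` + theorems; 0 `sorry`; standard axioms; no `instance`, no `notation`).  `--kind definition --supports stmt-QuantumFields-20544 --as helper`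
(count-neutral).  `bears_on: R4∕N16 · edges N05 → N16, N07 → N16 · out-edge N16 → N21 (stub 2 of K3⁷)`.

WHY THIS FILE EXISTS (LOCATED, first-hand reading of the REGISTERED K3⁷ skeleton OF RECORD — plan g82's v4 `pub-ymgap-plan/D82-K3V4/K3Skeleton13SepCoPHv4.lean` 17c74fac,
registered on stmt-QuantumFields-20544 2026-08-28T02:48:31Z; the same holds for v3 02f6f498).  Stub 1 reads `∃ β ∈ ]2∕3,1[, ∃ (𝔯 : RateReading₁₃CoPH 2) ksel ℓ, GuardedReading 𝔯 ksel ℓ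
∧ KeyedRatesHolderD4 β (rrOfRecord 𝔯 ksel)`; v4's `GuardedReading` (:260) = `Ne1PinnedOfRecord 𝔯` (reads `𝔯.ne1`) ∧ `KeyedLive (rrOfRecord 𝔯 ksel)` (reads `(𝔯.lit …).ne2`) ∧
`N15PinnedSized 𝔯` (reads `.ne2`) ∧ `U3PinnedKernels 𝔯 ℓ` (reads `.u3`) — in the plan's own gloss «all three object families `ne1 ∕ ne2 ∕ u3` pinned BY NAME»; the FOURTH family of
`RateObjects₁₁`, N16's NE3 layer `(𝔯.lit F θ hP g₀ os).ne3`, is read by NO conjunct.  The N16 conjunct of `KeyedRatesHolderD4` (v4: full prefix, `ForSmallCouplings` form) is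
`N16HolderAt (rrOfRecord 𝔯 ksel …).ne3 β` (`PHolderD4` → `SpineRatesHolder.RatesHolderAt` third conjunct → dag-n16-c `N16HolderAt c β = CovRootHolder … c.dom = ∀ k ≥ 1, ∀ V ∈ c.dom,
…`).  KERNEL CONSEQUENCE (§3): at the NE3-ERASED reading `eraseNE3 𝔯` (same `u3 ∕ ne2 ∕ ne1`; N16's layer := a constant object with `dom := ∅`) everything the pins, the guard and
the N14 ∕ N15 ∕ N17 ∕ N18 ∕ N22 ∕ (D4) ∕ ρ conjuncts read is UNCHANGED (`rfl` faces) while the N16 conjunct holds OUTRIGHT (`n16HolderAtReading_eraseNE3`;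
`ratesHolderAt_rateCarriers_eraseNE3_iff`: the β-rates at the erased reading ARE the rates with node N16 DELETED).  So stub 1 is closed on its N16 conjunct by NOTHING — the probe
`K3v4-N16-unpinned-probe.lean` attached to 20544 proves `stub_rates13H ↔ (∃ 𝔯 ksel ℓ, GuardedReading 𝔯 ksel ℓ ∧ KeyedRatesMinusN16 (rrOfRecord 𝔯 ksel))` (N16-FREE and
β-FREE) against v4's definitions VERBATIM — and stub 2's prover (node N21's core edge — this seat's row «N16 consumed by N21») receives N16 at an ARBITRARY NE3 object: node N16 is
ORPHANED from K3⁷ as registered (v1 read N16 at `readingOfRecord₁₃CoPH w1 ℓ₃ ne2 ne1`, whose only by-name-pinned component WAS RR-1's constant NE3 layer — dag-n22-w3 (q1), pub-ymgap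
INBOX l.24407; v2's move to `∃ 𝔯` + guards pinned the other families and left NE3 free).  The skeleton's names live in the planner's file, not in the tree, so they are not
named below.

WHAT THIS FILE OFFERS FOR THE NEXT EDITION (same class as v2's `N15PinnedSized` ∕ v3's `U3PinnedKernels` ∕ v4's `Ne1PinnedOfRecord`: a BY-NAME PIN to an object that EXISTS — RR-1's `ne3ConstLayerOfRecord₁₁`,
p467746 — with a letter reading `ℓ₃ : T4Family → NE3Letters₁₁` existential alongside `ℓ`; WHICH pin is the planners' (C1) word).  §1 `N16PinnedConst 𝔯 ℓ₃` (ALL data of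
record; VERBATIM the `hpin` binder of this seat's ₁₃ home modules; `readingOfRecord₁₃CoPH w1 ℓ₃ ne2 ne1` satisfies it by `rfl`) · `N16PinnedLoose 𝔯 ℓ₃ B` (the (C1)(i) LOOSE
edition: data CUT by print's (7)-ball `sfClass 4 F.L Nper ((ℓ₃ F).ε ∕ B F) 0`, [Balaban1985Variational] Thm 1 (7), `B` = print's `B₃` displayed — dag-n16-w1's loose-data object,
whose evidence #27 FRONTS locates the tight half of 37ᴴ's `h7` as model-false) · `N16LettersEnd N g ℓ₃` (THE END's letter rows per family = module 37ᴴ's per-family conclusion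
minus the slot: `g`, `Λ₁ = radiusOfRecordH`, `C = constOfRecordH`, `0 < b`, N21's numeral, `0 < Λ₂'`, `InEndRegimeH` — what node N21 reads; junk letters excluded) ·
`N16HolderAtReading 𝔯 β` (the N16 conjunct at EVERY tuple with core provisos and EVERY run length; implies the keyed ∕ level-selected one a fortiori).  §2 faces: under either
pin the bundle's NE3 component is RR-1's object BY NAME and `N16HolderAtReading 𝔯 β` is ONE tuple-free sentence per family.  §3 `eraseNE3` + «given ONE Stage-13 tuple with core
provisos (K0⁷'s content, HYPOTHESIS) the erased reading FAILS both pins».  §4 PRODUCERS BY NAME under the pins (letters chosen once for all readings): from 37ᴴ's in-edges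
`h5` ∧ `h7`; from node N05's two P-conjuncts (dag-n16-w2 42ᴾ `h5_of_t4P_p3P`) ∧ `h7`; and under the LOOSE pin from `h5` ∧ the loose leaf, hence from `h5` ∧ [Balaban1985Variational]
THEOREM 1 at leaf-06's torus instances DISPLAYED (dag-n16-w1 file 6 by name) — NO print-stronger `h7`.

HONEST FRAMING.  Definitions and kernel bookkeeping by name; no estimate; nothing of Bałaban asserted (every in-edge is a displayed hypothesis asserted for no family); N16 ∕ NE3
NOT discharged (`stub_h5` ∕ `stub_h7` of evidence #6 open as before); no admissible Stage-13 tuple claimed (K0⁷ OPEN); the skeleton of record is the planner's and is NOT edited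
here (none of its declarations is named); counts UNMOVED (typed 28∕28 · discharged 5∕27, A 5∕28); one finite four-torus at fixed ε — NOT ℝ⁴ ∕ infinite volume ∕ OS ∕ mass gap ∕ Clay.
-/

set_option autoImplicit false

open scoped BigOperators Matrix Matrix.Norms.L2Operator
open NormedSpace

namespace Summit.QuantumFields.YangMills.BalabanUVNodes.N16PinnedLayer13CoPH

open Literature.MathematicalPhysics.QuantumFieldTheory.Balaban1983to89
open Literature.MathematicalPhysics.QuantumFieldTheory.Balaban1983to89.T4Continuum (T4Family ULoop)
open B7Prop1Explicit B7Prop2Explicit MatrixLog UnitaryModel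
open T4AveragingDeficitWall hiding Site Plane Plaq Bond
open B7Prop3Flat (c3)
open B8LeafModelZd (ZdIdx)
open B8LeafModelZd3 (zdGF3)
open B8LeafModelZd3P (zdGF3P)
open B8IdxB8LawsB (IdxB8LawsB)
open Node00 (Stage13HParams NE3Objects₁₁ NE3Letters₁₁ NE2Objects₁₁ ne3ConstLayerOfRecord₁₁ ne3NperOfRecord₁₁ ne3DomOfRecord₁₁ one_le_ne3NperOfRecord₁₁
  populated_ne3ConstLayerOfRecord₁₁ MatA)
open Node00.W1 (ReadingData)
open Summit.QuantumFields.BalabanUV.T4Continuum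
open MinimalActionRate (sfClass)
open MinimalActionDictionary (torusVP RadiiMono)
open AveragingDeficitLatticeH2Prep (fd)
open B11Thm1 (Thm1At)
open NE3.LeafIndexSockets (LeafH3sup)
open YMDAG.UVSplit (Datum NE3Carriers NE1pCarriers RateCarriers N14At N15At N17At N18At N22At ne3OfRecord₁₁ RateReading₁₃CoPH rateCarriersOfRecord₁₃CoPH RRec₁₃CoPHOn
  readingOfRecord₁₃CoPH readingOfRecord₁₃CoPH_ne3)
open Summit.QuantumFields.YangMills.BalabanUVNodes.N16HolderDefs (N16HolderAt S_N16Holder)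
open Summit.QuantumFields.YangMills.BalabanUVNodes.N16HolderRegime (InEndRegimeH radiusOfRecordH constOfRecordH)
open Summit.QuantumFields.YangMills.BalabanUVNodes.SpineRatesHolder (RatesHolderAt)
open Summit.QuantumFields.YangMills.BalabanUVNodes.N16LeafSlotAllTorus (LeafSlotHolderAT n16HolderAt_of_inEndRegimeH_leafSlotHolderAT)
open Summit.QuantumFields.YangMills.BalabanUVNodes.N16LettersOfEdgesAllTorus (exists_letters_inEndRegimeH_leafSlotHolderAT_of_edges)
open Summit.QuantumFields.YangMills.BalabanUVNodes.N16AtRRec13CoPHLines (s_N16Holder_rRec₁₃CoPHOn_iff_ofRecord)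
open Summit.QuantumFields.YangMills.BalabanUVNodes.N16H5OfPSlot (h5_of_t4P_p3P)
open Summit.QuantumFields.YangMills.BalabanUVNodes.N16H7LooseOfThm1At (exists_letters_inEndRegimeH_leafSlotHolderAT_of_edges_loose
  exists_letters_inEndRegimeH_leafSlotHolderAT_of_h5_thm1At)

noncomputable section

variable {N : ℕ} [NeZero N]

/-! ## §1 The two N16 pins, THE END's letter rows, the N16 conjunct at a reading -/

/-- **THE N16 PIN — ALL DATA OF RECORD**: N16's NE3 layer of the Stage-13 rate reading `𝔯` at EVERY tuple with core provisos and EVERY run length IS RR-1's constant layer of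
record `ne3ConstLayerOfRecord₁₁ F N (ℓ₃ F)` (period `2L^m`, data = ALL `2L^m`-periodic `SU(N)` unit-lattice configurations, letters read by `ℓ₃`).  VERBATIM the `hconst ∕ hpin`
binder of this seat's ₁₃ home modules; `readingOfRecord₁₃CoPH w1 ℓ₃ ne2 ne1` satisfies it by `rfl` (§2).  A SHAPE for the planner's `GuardedReading`; asserted for no reading. [folklore] -/
@[folklore]
def N16PinnedConst (𝔯 : RateReading₁₃CoPH N) (ℓ₃ : T4Family → NE3Letters₁₁) : Prop :=
  ∀ (F : T4Family) (θ : Stage13HParams F N) (hP : θ.Provisos₁₃CoPH F N) (g₀ : ℕ → ℝ) (os : List (ULoop F)) (k : ℕ),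
    (𝔯.lit F θ hP g₀ os).ne3 k = ne3ConstLayerOfRecord₁₁ F N (ℓ₃ F)

/-- **THE N16 PIN — (C1)(i) LOOSE EDITION**: N16's layer IS the constant layer of record with its data CUT by print's (7)-ball of radius `(ℓ₃ F).ε ∕ B F` at level 0,
`{V | V ∈ ne3DomOfRecord₁₁ F N 0 0 ∧ V ∈ sfClass 4 F.L Nper ((ℓ₃ F).ε ∕ B F) 0}` — dag-n16-w1's loose-data object (`…N16H7LooseOfThm1At`), `B` displayed (print's `B₃`).
A SHAPE; asserted for no reading. [cite: Balaban1985Variational, Thm 1 (7) p.279] [folklore] -/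
@[folklore]
def N16PinnedLoose (𝔯 : RateReading₁₃CoPH N) (ℓ₃ : T4Family → NE3Letters₁₁) (B : T4Family → ℝ) : Prop :=
  ∀ (F : T4Family) (θ : Stage13HParams F N) (hP : θ.Provisos₁₃CoPH F N) (g₀ : ℕ → ℝ) (os : List (ULoop F)) (k : ℕ),
    (𝔯.lit F θ hP g₀ os).ne3 k =
      { ne3ConstLayerOfRecord₁₁ F N (ℓ₃ F) with
        dom := {V | V ∈ ne3DomOfRecord₁₁ F N 0 0 ∧ V ∈ sfClass 4 F.L (ne3NperOfRecord₁₁ F 0 0) ((ℓ₃ F).ε / B F) 0} }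

variable (N) in
/-- **THE END's LETTER ROWS, PER FAMILY** (module 37ᴴ's per-family conclusion minus the slot): coupling letter `g F`, `Λ₁ = radiusOfRecordH`, `C = constOfRecordH`, `0 < b`,
node N21's numeral `512·(4+1)·(4+4)·L²·b ≤ 1`, `0 < Λ₂'`, and THE END's β-uniform regime `InEndRegimeH` at RR-1's object.  What node N21 reads off N16's letters; excludes junk
letters (`ε ≤ 0`, `C` below THE END's constant, …).  A SHAPE. [folklore] -/
@[folklore]
def N16LettersEnd (g : T4Family → ℝ) (ℓ₃ : T4Family → NE3Letters₁₁) : Prop :=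
  ∀ F : T4Family, (ℓ₃ F).g = g F ∧ (ℓ₃ F).Λ₁ = radiusOfRecordH N F.L (ne3NperOfRecord₁₁ F 0 0) ∧
    (ℓ₃ F).C = constOfRecordH N F.L (ne3NperOfRecord₁₁ F 0 0) (g F) ∧
    0 < (ℓ₃ F).b ∧ 512 * (4 + 1) * (4 + 4) * (F.L : ℝ) ^ 2 * (ℓ₃ F).b ≤ 1 ∧ 0 < (ℓ₃ F).Λ₂' ∧
    InEndRegimeH (ne3OfRecord₁₁ F (ne3ConstLayerOfRecord₁₁ F N (ℓ₃ F)))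

/-- **THE N16 CONJUNCT AT A READING**: `N16HolderAt (rateCarriersOfRecord₁₃CoPH 𝔯 F θ hP g₀ os k).ne3 β` at EVERY Stage-13 tuple with core provisos, every `g₀`, `os`, EVERY run
length `k` — the skeleton's N16 conjunct at `𝔯` with prefix, guards, `ForSmallCouplings` and selector dropped (implies the keyed one a fortiori).  A SHAPE. [folklore] -/
@[folklore]
def N16HolderAtReading (𝔯 : RateReading₁₃CoPH N) (β : ℝ) : Prop :=
  ∀ (F : T4Family) (θ : Stage13HParams F N) (hP : θ.Provisos₁₃CoPH F N) (g₀ : ℕ → ℝ) (os : List (ULoop F)) (k : ℕ),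
    N16HolderAt (rateCarriersOfRecord₁₃CoPH 𝔯 F θ hP g₀ os k).ne3 β

/-! ## §1b THE END's regime does not read the data; dag-n16-c's β-sentence is vacuous on empty data -/

/-- **THE END's REGIME DOES NOT READ THE DATA**: `InEndRegimeH` at the loose-data object IS `InEndRegimeH` at the constant layer (`Iff.rfl`) — so `N16LettersEnd` serves both pins. [folklore] -/
theorem inEndRegimeH_loose_iff (F : T4Family) (ℓ : NE3Letters₁₁) (r : ℝ) :
    InEndRegimeH (ne3OfRecord₁₁ F { ne3ConstLayerOfRecord₁₁ F N ℓ with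
      dom := {V | V ∈ ne3DomOfRecord₁₁ F N 0 0 ∧ V ∈ sfClass 4 F.L (ne3NperOfRecord₁₁ F 0 0) r 0} }) ↔
    InEndRegimeH (ne3OfRecord₁₁ F (ne3ConstLayerOfRecord₁₁ F N ℓ)) := Iff.rfl

omit [NeZero N] in
/-- **dag-n16-c's β-sentence IS VACUOUS ON EMPTY DATA** (`CovRootHolder … dom = ∀ k ≥ 1, ∀ V ∈ dom, …`). [folklore] -/
theorem n16HolderAt_of_dom_eq_empty {c : NE3Carriers N} (h : c.dom = ∅) (β : ℝ) : N16HolderAt c β := by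
  intro k _ V hV
  rw [h] at hV
  exact absurd hV (Set.notMem_empty V)

/-! ## §2 Faces -/

section Faces

variable (𝔯 : RateReading₁₃CoPH N) (ℓ₃ : T4Family → NE3Letters₁₁) (B : T4Family → ℝ) (β : ℝ)

/-- **dag-n22-e's READING OF RECORD SATISFIES THE CONST PIN** with its own letters (`rfl` — `readingOfRecord₁₃CoPH_ne3`). [folklore] -/
theorem n16PinnedConst_readingOfRecord₁₃CoPH (w1 : (F : T4Family) → (θ : Stage13HParams F N) → ReadingData F (MatA N) θ.τ9.M)
    (ne2 : (F : T4Family) → Stage13HParams F N → (ℕ → ℝ) → List (ULoop F) → ℕ → NE2Objects₁₁)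
    (ne1 : (F : T4Family) → Stage13HParams F N → (ℕ → ℝ) → List (ULoop F) → NE1pCarriers) :
    N16PinnedConst (readingOfRecord₁₃CoPH w1 ℓ₃ ne2 ne1) ℓ₃ :=
  readingOfRecord₁₃CoPH_ne3 w1 ℓ₃ ne2 ne1

variable {𝔯 ℓ₃ B}

/-- Under the const pin the bundle's NE3 component IS RR-1's object of record. [folklore] -/
theorem rateCarriers_ne3_of_pinnedConst (h : N16PinnedConst 𝔯 ℓ₃) (F : T4Family) (θ : Stage13HParams F N) (hP : θ.Provisos₁₃CoPH F N) (g₀ : ℕ → ℝ)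
    (os : List (ULoop F)) (k : ℕ) :
    (rateCarriersOfRecord₁₃CoPH 𝔯 F θ hP g₀ os k).ne3 = ne3OfRecord₁₁ F (ne3ConstLayerOfRecord₁₁ F N (ℓ₃ F)) := by
  show ne3OfRecord₁₁ F ((𝔯.lit F θ hP g₀ os).ne3 k) = _
  rw [h]

/-- Under the loose pin the bundle's NE3 component IS the loose-data object. [folklore] -/
theorem rateCarriers_ne3_of_pinnedLoose (h : N16PinnedLoose 𝔯 ℓ₃ B) (F : T4Family) (θ : Stage13HParams F N) (hP : θ.Provisos₁₃CoPH F N) (g₀ : ℕ → ℝ)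
    (os : List (ULoop F)) (k : ℕ) :
    (rateCarriersOfRecord₁₃CoPH 𝔯 F θ hP g₀ os k).ne3 =
      ne3OfRecord₁₁ F { ne3ConstLayerOfRecord₁₁ F N (ℓ₃ F) with
        dom := {V | V ∈ ne3DomOfRecord₁₁ F N 0 0 ∧ V ∈ sfClass 4 F.L (ne3NperOfRecord₁₁ F 0 0) ((ℓ₃ F).ε / B F) 0} } := by
  show ne3OfRecord₁₁ F ((𝔯.lit F θ hP g₀ os).ne3 k) = _
  rw [h]

/-- **★ UNDER THE CONST PIN THE N16 CONJUNCT AT THE READING IS ONE TUPLE-FREE SENTENCE PER FAMILY** about RR-1's object — for every family carrying a Stage-13 tuple with core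
provisos, `N16HolderAt (ne3OfRecord₁₁ F (ne3ConstLayerOfRecord₁₁ F N (ℓ₃ F))) β`. [folklore] -/
theorem n16HolderAtReading_iff_of_pinnedConst (h : N16PinnedConst 𝔯 ℓ₃) :
    N16HolderAtReading 𝔯 β ↔ ∀ F : T4Family, (∃ θ : Stage13HParams F N, θ.Provisos₁₃CoPH F N) →
      N16HolderAt (ne3OfRecord₁₁ F (ne3ConstLayerOfRecord₁₁ F N (ℓ₃ F))) β := by
  constructor
  · rintro H F ⟨θ, hP⟩
    rw [← rateCarriers_ne3_of_pinnedConst h F θ hP (fun _ => 0) [] 0]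
    exact H F θ hP (fun _ => 0) [] 0
  · intro H F θ hP g₀ os k
    rw [rateCarriers_ne3_of_pinnedConst h F θ hP g₀ os k]
    exact H F ⟨θ, hP⟩

/-- … in particular. [folklore] -/
theorem n16HolderAtReading_of_pinnedConst (h : N16PinnedConst 𝔯 ℓ₃) (H : ∀ F : T4Family, N16HolderAt (ne3OfRecord₁₁ F (ne3ConstLayerOfRecord₁₁ F N (ℓ₃ F))) β) :
    N16HolderAtReading 𝔯 β :=
  (n16HolderAtReading_iff_of_pinnedConst β h).2 fun F _ => H F

/-- **★ THE SAME UNDER THE LOOSE PIN**, at the loose-data object. [folklore] -/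
theorem n16HolderAtReading_iff_of_pinnedLoose (h : N16PinnedLoose 𝔯 ℓ₃ B) :
    N16HolderAtReading 𝔯 β ↔ ∀ F : T4Family, (∃ θ : Stage13HParams F N, θ.Provisos₁₃CoPH F N) →
      N16HolderAt (ne3OfRecord₁₁ F { ne3ConstLayerOfRecord₁₁ F N (ℓ₃ F) with
        dom := {V | V ∈ ne3DomOfRecord₁₁ F N 0 0 ∧ V ∈ sfClass 4 F.L (ne3NperOfRecord₁₁ F 0 0) ((ℓ₃ F).ε / B F) 0} }) β := by
  constructor
  · rintro H F ⟨θ, hP⟩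
    rw [← rateCarriers_ne3_of_pinnedLoose h F θ hP (fun _ => 0) [] 0]
    exact H F θ hP (fun _ => 0) [] 0
  · intro H F θ hP g₀ os k
    rw [rateCarriers_ne3_of_pinnedLoose h F θ hP g₀ os k]
    exact H F ⟨θ, hP⟩

/-- … in particular. [folklore] -/
theorem n16HolderAtReading_of_pinnedLoose (h : N16PinnedLoose 𝔯 ℓ₃ B)
    (H : ∀ F : T4Family, N16HolderAt (ne3OfRecord₁₁ F { ne3ConstLayerOfRecord₁₁ F N (ℓ₃ F) with
      dom := {V | V ∈ ne3DomOfRecord₁₁ F N 0 0 ∧ V ∈ sfClass 4 F.L (ne3NperOfRecord₁₁ F 0 0) ((ℓ₃ F).ε / B F) 0} }) β) :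
    N16HolderAtReading 𝔯 β :=
  (n16HolderAtReading_iff_of_pinnedLoose β h).2 fun F _ => H F

/-- **THE `h16`-HOME FACE**: under the const pin, dag-n16-c's β-stub at the regime-restricted home `RRec₁₃CoPHOn 𝔯 Rg` IS the per-family sentence at RR-1's object for every family
carrying a tuple in the regime (this seat's `…N16AtRRec13CoPHLines.s_N16Holder_rRec₁₃CoPHOn_iff_ofRecord`, whose `hpin` binder the pin IS). [folklore] -/
theorem s_N16Holder_rRec₁₃CoPHOn_iff_of_pinnedConst (Rg : (F : T4Family) → Stage13HParams F N → Prop) (h : N16PinnedConst 𝔯 ℓ₃) :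
    S_N16Holder β (RRec₁₃CoPHOn 𝔯 Rg) ↔ ∀ F : T4Family, (∃ θ : Stage13HParams F N, θ.Provisos₁₃CoPH F N ∧ Rg F θ ∧ θ.Admissible F N) →
      N16HolderAt (ne3OfRecord₁₁ F (ne3ConstLayerOfRecord₁₁ F N (ℓ₃ F))) β :=
  s_N16Holder_rRec₁₃CoPHOn_iff_ofRecord β 𝔯 Rg ℓ₃ h

end Faces

/-! ## §3 The vacuity witness: the NE3-ERASED reading (why a K3 skeleton reading N16 off `∃ 𝔯` must pin the NE3 layer) -/

/-- **THE NE3-ERASED READING**: `u3 ∕ ne2 ∕ ne1` are `𝔯`'s; N16's layer := the NE3 object with all letters `0` and NO data (`dom := ∅`).  For the located finding only. [folklore] -/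
@[folklore]
def eraseNE3 (𝔯 : RateReading₁₃CoPH N) : RateReading₁₃CoPH N :=
  ⟨fun F θ hP g₀ os => { 𝔯.lit F θ hP g₀ os with ne3 := fun _ => ⟨0, 0, 0, 0, 0, 0, 0, ∅⟩ }, 𝔯.ne1⟩

section Erase

variable (𝔯 : RateReading₁₃CoPH N) {F : T4Family} (θ : Stage13HParams F N) (hP : θ.Provisos₁₃CoPH F N) (g₀ : ℕ → ℝ) (os : List (ULoop F)) (k : ℕ)

/-- Face (`rfl`): its dressed tower is `𝔯`'s — what the N14 pin and conjunct read. [folklore] -/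
theorem eraseNE3_ne1 : (eraseNE3 𝔯).ne1 F θ hP g₀ os = 𝔯.ne1 F θ hP g₀ os := rfl

/-- Face (`rfl`): its node-U3 objects are `𝔯`'s — what the U3 pin, N18's guard, N17 ∕ N18 ∕ N22 ∕ (D4) and the ρ letter read. [folklore] -/
theorem eraseNE3_lit_u3 : ((eraseNE3 𝔯).lit F θ hP g₀ os).u3 = (𝔯.lit F θ hP g₀ os).u3 := rfl

/-- Face (`rfl`): its N15 layers are `𝔯`'s — what the N15 pin, N15's guard and conjunct read. [folklore] -/
theorem eraseNE3_lit_ne2 : ((eraseNE3 𝔯).lit F θ hP g₀ os).ne2 k = (𝔯.lit F θ hP g₀ os).ne2 k := rfl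

/-- Face (`rfl`) at the bundle of record: `ne1` unchanged. [folklore] -/
theorem rateCarriers_eraseNE3_ne1 : (rateCarriersOfRecord₁₃CoPH (eraseNE3 𝔯) F θ hP g₀ os k).ne1 = (rateCarriersOfRecord₁₃CoPH 𝔯 F θ hP g₀ os k).ne1 := rfl

/-- Face (`rfl`) at the bundle of record: `ne2` unchanged. [folklore] -/
theorem rateCarriers_eraseNE3_ne2 : (rateCarriersOfRecord₁₃CoPH (eraseNE3 𝔯) F θ hP g₀ os k).ne2 = (rateCarriersOfRecord₁₃CoPH 𝔯 F θ hP g₀ os k).ne2 := rfl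

/-- Face (`rfl`) at the bundle of record: `u3` unchanged. [folklore] -/
theorem rateCarriers_eraseNE3_u3 : (rateCarriersOfRecord₁₃CoPH (eraseNE3 𝔯) F θ hP g₀ os k).u3 = (rateCarriersOfRecord₁₃CoPH 𝔯 F θ hP g₀ os k).u3 := rfl

/-- **★ THE N16 CONJUNCT HOLDS OUTRIGHT AT THE ERASED READING** — at every tuple, every run length, every `β`. [folklore] -/
theorem n16HolderAtReading_eraseNE3 (β : ℝ) : N16HolderAtReading (eraseNE3 𝔯) β :=
  fun _ _ _ _ _ _ => n16HolderAt_of_dom_eq_empty rfl β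

/-- **★ THE β-RATES AT THE ERASED READING ARE THE RATES WITH NODE N16 DELETED** (kernel): `RatesHolderAt D (bundle of eraseNE3 𝔯) β ↔ N14 ∧ N15 ∧ N17 ∧ N18 ∧ N22 at the
bundle of 𝔯` — the N16 conjunct contributes NOTHING at a reading whose NE3 layer is not pinned. [folklore] -/
theorem ratesHolderAt_rateCarriers_eraseNE3_iff (D : Datum F N) (β : ℝ) :
    RatesHolderAt D (rateCarriersOfRecord₁₃CoPH (eraseNE3 𝔯) F θ hP g₀ os k) β ↔
      N14At (rateCarriersOfRecord₁₃CoPH 𝔯 F θ hP g₀ os k).ne1 ∧ N15At (rateCarriersOfRecord₁₃CoPH 𝔯 F θ hP g₀ os k).ne2 ∧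
        N17At D (rateCarriersOfRecord₁₃CoPH 𝔯 F θ hP g₀ os k).u3 ∧ N18At (rateCarriersOfRecord₁₃CoPH 𝔯 F θ hP g₀ os k).u3 ∧
        N22At (rateCarriersOfRecord₁₃CoPH 𝔯 F θ hP g₀ os k).u3 :=
  ⟨fun h => ⟨h.1, h.2.1, h.2.2.2.1, h.2.2.2.2.1, h.2.2.2.2.2⟩,
    fun h => ⟨h.1, h.2.1, n16HolderAtReading_eraseNE3 𝔯 β F θ hP g₀ os k, h.2.2.1, h.2.2.2.1, h.2.2.2.2⟩⟩

/-- **GIVEN ONE STAGE-13 TUPLE WITH CORE PROVISOS (K0⁷'s content, HYPOTHESIS) THE ERASED READING FAILS THE CONST PIN** — the constant layer of record is populated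
(`populated_ne3ConstLayerOfRecord₁₁`), the erased layer is not. [folklore] -/
theorem not_n16PinnedConst_eraseNE3 (ℓ₃ : T4Family → NE3Letters₁₁) {F : T4Family} (θ : Stage13HParams F N) (hP : θ.Provisos₁₃CoPH F N) :
    ¬ N16PinnedConst (eraseNE3 𝔯) ℓ₃ := by
  intro h
  have hne : (((eraseNE3 𝔯).lit F θ hP (fun _ => 0) []).ne3 0).Populated := by
    rw [h F θ hP (fun _ => 0) [] 0]
    exact populated_ne3ConstLayerOfRecord₁₁ F N (ℓ₃ F)
  exact Set.not_nonempty_empty hne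

/-- **… AND FAILS THE LOOSE PIN whenever the loose data are non-empty** (displayed). [folklore] -/
theorem not_n16PinnedLoose_eraseNE3_of_nonempty (ℓ₃ : T4Family → NE3Letters₁₁) (B : T4Family → ℝ) {F : T4Family} (θ : Stage13HParams F N)
    (hP : θ.Provisos₁₃CoPH F N)
    (hne : ({V | V ∈ ne3DomOfRecord₁₁ F N 0 0 ∧ V ∈ sfClass 4 F.L (ne3NperOfRecord₁₁ F 0 0) ((ℓ₃ F).ε / B F) 0} :
      Set ((Fin 4 → ℤ) → Fin 4 → (MatA N)ˣ)).Nonempty) :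
    ¬ N16PinnedLoose (eraseNE3 𝔯) ℓ₃ B := by
  intro h
  have hne' : (((eraseNE3 𝔯).lit F θ hP (fun _ => 0) []).ne3 0).Populated := by
    rw [h F θ hP (fun _ => 0) [] 0]
    exact hne
  exact Set.not_nonempty_empty hne'

end Erase

/-! ## §4 The producers BY NAME under each pin (letters chosen once, for all readings) -/

section Producers

variable {β : ℝ} (hβ0 : 0 ≤ β) (hβ1 : β ≤ 1)
include hβ0 hβ1

/-- **★ UNDER THE CONST PIN, FROM 37ᴴ's TWO IN-EDGES** (R-β, `0 ≤ β ≤ 1`): node N05's Thm-4 ∕ Prop-3 bodies on the pinned all-torus proper sub-family of `zdGF3 (M_N ℂ) F.L β len`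
with their constants and window (`h5`, VERBATIM 37ᴴ's), node N07's linear leaf on ALL data of record (`h7`, VERBATIM 37ᴴ's), and a coupling letter `g F > 0` give letters
`ℓ₃` carrying THE END's rows such that EVERY reading pinned to them satisfies the N16 conjunct at every tuple and run length (module 35's per-family letters ∘ module 32's
closer ∘ §2). [folklore] -/
theorem exists_letters_n16HolderAtReading_of_edges_allTorus {g : T4Family → ℝ} (hg : ∀ F, 0 < g F)
    (h5 : ∀ F : T4Family, letI : CStarAlgebra (Matrix (Fin N) (Fin N) ℂ) := {}
      ∃ (len : Site 4 → ℝ) (c₁ c₁' B₁' cP C₂ B₀β : ℝ) (inp : B8.B9Inputs),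
        (∀ v : Site 4, 0 < len v → 1 ≤ len v) ∧ (∀ μ : Fin 4, len (e μ) = 1) ∧ 0 < B₁' ∧ 5 * ((4 : ℕ) : ℝ) * F.L * inp.B₀ ≤ B₁' ∧ 0 < c₁' ∧
        (∀ α₀ α₁ : ℝ, 0 < α₀ → 0 < α₁ → α₀ + α₁ ≤ c₁' →
          α₀ + α₁ ≤ c₁ ∧ C0 4 * (2 * α₀) ≤ 1 / 3 ∧ 4 * α₀ ≤ c2' 4 F.L ∧ 16 * (B₁' * (α₀ + α₁)) ≤ 1 ∧
          Real.exp (4 * (800 * (((4 : ℕ) : ℝ) + 1) ^ 2 * (((4 : ℕ) : ℝ) + 4)) * α₀) * (1 + 8 * (131072 * (((4 : ℕ) : ℝ) + 1) ^ 2) * (B₁' * (α₀ + α₁))) ≤ 2 ∧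
          2 * (B₁' * (α₀ + α₁)) ≤ c3 4 F.L ∧ ((4 : ℕ) : ℝ) * F.L * α₁ ≤ 1 / 8 ∧ α₀ ≤ cP ∧ α₁ ≤ cP ∧ B₁' * (α₀ + α₁) ≤ cP ∧
          2 * (B₁' * (α₀ + α₁)) ^ 2 + 20 * ((4 : ℕ) : ℝ) * α₀ * (B₁' * (α₀ + α₁)) + 2 * C₂ * (B₁' * (α₀ + α₁)) ^ 2 ≤ α₀ + α₁) ∧
        B8.Thm4Body c₁ B₁' (fun i : {i : ZdIdx 4 F.L // (∀ j, i.Ω j = Set.univ) ∧ (∀ m j, i.Λs m j = {_y | j = m}) ∧ (∀ m j, i.Λb m j = {_c | j = m}) ∧ i.η = ((F.L : ℝ)⁻¹) ^ i.k} => (zdGF3 (Matrix (Fin N) (Fin N) ℂ) F.L β len i.1).toGFData) ∧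
        B8.Prop3Body cP 4 (F.L : ℝ) C₂ inp B₀β (fun i : {i : ZdIdx 4 F.L // (∀ j, i.Ω j = Set.univ) ∧ (∀ m j, i.Λs m j = {_y | j = m}) ∧ (∀ m j, i.Λb m j = {_c | j = m}) ∧ i.η = ((F.L : ℝ)⁻¹) ^ i.k} => (zdGF3 (Matrix (Fin N) (Fin N) ℂ) F.L β len i.1).toGFData2))
    (h7 : ∀ F : T4Family, ∃ C ε₀ : ℝ, 0 ≤ C ∧ 0 < ε₀ ∧ ∀ ε : ℝ, 0 < ε → ε ≤ ε₀ →
      LeafH3sup 4 F.L (ne3NperOfRecord₁₁ F 0 0) ε (C * ε) (C * ε) (ne3DomOfRecord₁₁ F N 0 0)) :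
    ∃ ℓ₃ : T4Family → NE3Letters₁₁, N16LettersEnd N g ℓ₃ ∧ ∀ 𝔯 : RateReading₁₃CoPH N, N16PinnedConst 𝔯 ℓ₃ → N16HolderAtReading 𝔯 β := by
  choose ℓ₃ hℓ₃ using fun F => exists_letters_inEndRegimeH_leafSlotHolderAT_of_edges (N := N) F (hg F) (h5 F) (h7 F)
  refine ⟨ℓ₃, fun F => ⟨(hℓ₃ F).1, (hℓ₃ F).2.1, (hℓ₃ F).2.2.1, (hℓ₃ F).2.2.2.1, (hℓ₃ F).2.2.2.2.1, (hℓ₃ F).2.2.2.2.2.1, (hℓ₃ F).2.2.2.2.2.2.1⟩,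
    fun 𝔯 hpin => n16HolderAtReading_of_pinnedConst β hpin fun F => ?_⟩
  exact n16HolderAt_of_inEndRegimeH_leafSlotHolderAT (hℓ₃ F).2.2.2.2.2.2.1 hβ0 hβ1 (hℓ₃ F).2.2.2.2.2.2.2

/-- **★ UNDER THE CONST PIN, FROM NODE N05's TWO P-CONJUNCTS AND `h7`** (R-β): `Thm4Printed` ∧ `Prop3Printed` AS PRINTED on dag-n05-w1's P-carrier over dag-n05-c's four-law
sub-index at `(M_N ℂ, 4, F.L)` with the four side letters (`hP`, VERBATIM dag-n16-w2's p596700), `h7` and `g F > 0` give pinned letters with the N16 conjunct at every pinned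
reading (dag-n16-w2 42ᴾ `h5_of_t4P_p3P` ∘ the previous theorem). [cite: Balaban1985RegularSpaces, Thm 4 p.88, Prop. 3 p.87] [folklore] -/
theorem exists_letters_n16HolderAtReading_of_pConjuncts_allTorus {g : T4Family → ℝ} (hg : ∀ F, 0 < g F)
    (hP : ∀ F : T4Family, letI : CStarAlgebra (Matrix (Fin N) (Fin N) ℂ) := {}
      ∃ (len : Site 4 → ℝ) (B₁' C₂ B₀β : ℝ) (inp : B8.B9Inputs),
        (∀ v : Site 4, 0 < len v → 1 ≤ len v) ∧ (∀ μ : Fin 4, len (e μ) = 1) ∧ 0 < B₁' ∧ 5 * ((4 : ℕ) : ℝ) * F.L * inp.B₀ ≤ B₁' ∧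
        B8.Thm4Printed B₁' (fun j : {i : {i : ZdIdx 4 F.L // i.Ω 0 = Set.univ} // IdxB8LawsB F.L i.1} => (zdGF3P (Matrix (Fin N) (Fin N) ℂ) F.L β len j.1.1).toGFData) ∧
        B8.Prop3Printed 4 (F.L : ℝ) C₂ inp B₀β (fun j : {i : {i : ZdIdx 4 F.L // i.Ω 0 = Set.univ} // IdxB8LawsB F.L i.1} => (zdGF3P (Matrix (Fin N) (Fin N) ℂ) F.L β len j.1.1).toGFData2))
    (h7 : ∀ F : T4Family, ∃ C ε₀ : ℝ, 0 ≤ C ∧ 0 < ε₀ ∧ ∀ ε : ℝ, 0 < ε → ε ≤ ε₀ →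
      LeafH3sup 4 F.L (ne3NperOfRecord₁₁ F 0 0) ε (C * ε) (C * ε) (ne3DomOfRecord₁₁ F N 0 0)) :
    ∃ ℓ₃ : T4Family → NE3Letters₁₁, N16LettersEnd N g ℓ₃ ∧ ∀ 𝔯 : RateReading₁₃CoPH N, N16PinnedConst 𝔯 ℓ₃ → N16HolderAtReading 𝔯 β :=
  exists_letters_n16HolderAtReading_of_edges_allTorus hβ0 hβ1 hg
    (fun F => by
      obtain ⟨len, B₁', C₂, B₀β, inp, hlen, hlen1, hB₁', hBB, t4, p3⟩ := hP F
      exact h5_of_t4P_p3P F.hL.2 β hlen hlen1 hB₁' hBB t4 p3)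
    h7

/-- **★ UNDER THE LOOSE PIN, FROM `h5` AND THE LOOSE LEAF** (R-β): `h5` as above, `g F > 0`, and node N07's linear leaf ON PRINT's LOOSE DATA ONLY — `LeafH3sup … ε (C·ε) (C·ε)
{V | V ∈ ne3DomOfRecord₁₁ F N 0 0 ∧ V ∈ sfClass 4 F.L Nper (ε ∕ B F) 0}` for `0 < ε ≤ ε₀` — give letters with THE END's rows such that every reading pinned LOOSE to them satisfies the
N16 conjunct (dag-n16-w1 `exists_letters_inEndRegimeH_leafSlotHolderAT_of_edges_loose` ∘ module 32's closer ∘ §2). [cite: Balaban1985Variational, Thm 1 (7)–(10) p.279] [folklore] -/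
theorem exists_letters_n16HolderAtReading_loose_of_edges {g : T4Family → ℝ} (hg : ∀ F, 0 < g F)
    (h5 : ∀ F : T4Family, letI : CStarAlgebra (Matrix (Fin N) (Fin N) ℂ) := {}
      ∃ (len : Site 4 → ℝ) (c₁ c₁' B₁' cP C₂ B₀β : ℝ) (inp : B8.B9Inputs),
        (∀ v : Site 4, 0 < len v → 1 ≤ len v) ∧ (∀ μ : Fin 4, len (e μ) = 1) ∧ 0 < B₁' ∧ 5 * ((4 : ℕ) : ℝ) * F.L * inp.B₀ ≤ B₁' ∧ 0 < c₁' ∧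
        (∀ α₀ α₁ : ℝ, 0 < α₀ → 0 < α₁ → α₀ + α₁ ≤ c₁' →
          α₀ + α₁ ≤ c₁ ∧ C0 4 * (2 * α₀) ≤ 1 / 3 ∧ 4 * α₀ ≤ c2' 4 F.L ∧ 16 * (B₁' * (α₀ + α₁)) ≤ 1 ∧
          Real.exp (4 * (800 * (((4 : ℕ) : ℝ) + 1) ^ 2 * (((4 : ℕ) : ℝ) + 4)) * α₀) * (1 + 8 * (131072 * (((4 : ℕ) : ℝ) + 1) ^ 2) * (B₁' * (α₀ + α₁))) ≤ 2 ∧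
          2 * (B₁' * (α₀ + α₁)) ≤ c3 4 F.L ∧ ((4 : ℕ) : ℝ) * F.L * α₁ ≤ 1 / 8 ∧ α₀ ≤ cP ∧ α₁ ≤ cP ∧ B₁' * (α₀ + α₁) ≤ cP ∧
          2 * (B₁' * (α₀ + α₁)) ^ 2 + 20 * ((4 : ℕ) : ℝ) * α₀ * (B₁' * (α₀ + α₁)) + 2 * C₂ * (B₁' * (α₀ + α₁)) ^ 2 ≤ α₀ + α₁) ∧
        B8.Thm4Body c₁ B₁' (fun i : {i : ZdIdx 4 F.L // (∀ j, i.Ω j = Set.univ) ∧ (∀ m j, i.Λs m j = {_y | j = m}) ∧ (∀ m j, i.Λb m j = {_c | j = m}) ∧ i.η = ((F.L : ℝ)⁻¹) ^ i.k} => (zdGF3 (Matrix (Fin N) (Fin N) ℂ) F.L β len i.1).toGFData) ∧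
        B8.Prop3Body cP 4 (F.L : ℝ) C₂ inp B₀β (fun i : {i : ZdIdx 4 F.L // (∀ j, i.Ω j = Set.univ) ∧ (∀ m j, i.Λs m j = {_y | j = m}) ∧ (∀ m j, i.Λb m j = {_c | j = m}) ∧ i.η = ((F.L : ℝ)⁻¹) ^ i.k} => (zdGF3 (Matrix (Fin N) (Fin N) ℂ) F.L β len i.1).toGFData2))
    {B : T4Family → ℝ}
    (h7L : ∀ F : T4Family, ∃ C ε₀ : ℝ, 0 ≤ C ∧ 0 < ε₀ ∧ ∀ ε : ℝ, 0 < ε → ε ≤ ε₀ →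
      LeafH3sup 4 F.L (ne3NperOfRecord₁₁ F 0 0) ε (C * ε) (C * ε)
        {V | V ∈ ne3DomOfRecord₁₁ F N 0 0 ∧ V ∈ sfClass 4 F.L (ne3NperOfRecord₁₁ F 0 0) (ε / B F) 0}) :
    ∃ ℓ₃ : T4Family → NE3Letters₁₁, N16LettersEnd N g ℓ₃ ∧ ∀ 𝔯 : RateReading₁₃CoPH N, N16PinnedLoose 𝔯 ℓ₃ B → N16HolderAtReading 𝔯 β := by
  choose ℓ₃ hℓ₃ using fun F => exists_letters_inEndRegimeH_leafSlotHolderAT_of_edges_loose (N := N) F (hg F) (h5 F) (h7L F)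
  refine ⟨ℓ₃, fun F => ⟨(hℓ₃ F).1, (hℓ₃ F).2.1, (hℓ₃ F).2.2.1, (hℓ₃ F).2.2.2.1, (hℓ₃ F).2.2.2.2.1, (hℓ₃ F).2.2.2.2.2.1,
    (inEndRegimeH_loose_iff F (ℓ₃ F) _).1 (hℓ₃ F).2.2.2.2.2.2.1⟩, fun 𝔯 hpin => n16HolderAtReading_of_pinnedLoose β hpin fun F => ?_⟩
  exact n16HolderAt_of_inEndRegimeH_leafSlotHolderAT (hℓ₃ F).2.2.2.2.2.2.1 hβ0 hβ1 (hℓ₃ F).2.2.2.2.2.2.2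

/-- **★ UNDER THE LOOSE PIN AT RADIUS `ε ∕ B₃`, FROM `h5` AND [B11] THEOREM 1 AT LEAF-06's TORUS INSTANCES — NO `h7`** (R-β): `h5`, `g F > 0`, and per family leaf-06's
Theorem-1 reading EXACTLY as in dag-n16-w1's files 1 ∕ 6 — a local-gauge shape `G F` monotone in its radii (`RadiiMono`) with the (9)_{β₀=1} interface binder `hG`, constants
`C F : B11Thm1.Consts` with `M(ε₁) ≥ 7∕2` on `(0, a₁]`, and `hT : ∀ k, Thm1At (C F) (torusVP 4 F.L Nper (G F) (k+1))` ([Balaban1985Variational] Thm 1 p. 279 for the torus instances of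
`MinimalActionDictionary` §4 — DISPLAYED, asserted for nothing) — give letters with THE END's rows such that every reading pinned LOOSE at radius `(ℓ₃ F).ε ∕ (C F).B₃` satisfies the
N16 conjunct at every tuple and run length (dag-n16-w1 `exists_letters_inEndRegimeH_leafSlotHolderAT_of_h5_thm1At` ∘ module 32's closer ∘ §2).  This is the (C1)(i) ROAD IN THE
SKELETON's CURRENCY: under the loose pin node N16's K3⁷ conjunct costs Theorem 1 and node N05's conjuncts, nothing print-stronger. [cite: Balaban1985Variational, Thm 1 (8)–(10) p.279] [folklore] -/
theorem exists_letters_n16HolderAtReading_loose_of_h5_thm1At {g : T4Family → ℝ} (hg : ∀ F, 0 < g F)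
    (h5 : ∀ F : T4Family, letI : CStarAlgebra (Matrix (Fin N) (Fin N) ℂ) := {}
      ∃ (len : Site 4 → ℝ) (c₁ c₁' B₁' cP C₂ B₀β : ℝ) (inp : B8.B9Inputs),
        (∀ v : Site 4, 0 < len v → 1 ≤ len v) ∧ (∀ μ : Fin 4, len (e μ) = 1) ∧ 0 < B₁' ∧ 5 * ((4 : ℕ) : ℝ) * F.L * inp.B₀ ≤ B₁' ∧ 0 < c₁' ∧
        (∀ α₀ α₁ : ℝ, 0 < α₀ → 0 < α₁ → α₀ + α₁ ≤ c₁' →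
          α₀ + α₁ ≤ c₁ ∧ C0 4 * (2 * α₀) ≤ 1 / 3 ∧ 4 * α₀ ≤ c2' 4 F.L ∧ 16 * (B₁' * (α₀ + α₁)) ≤ 1 ∧
          Real.exp (4 * (800 * (((4 : ℕ) : ℝ) + 1) ^ 2 * (((4 : ℕ) : ℝ) + 4)) * α₀) * (1 + 8 * (131072 * (((4 : ℕ) : ℝ) + 1) ^ 2) * (B₁' * (α₀ + α₁))) ≤ 2 ∧
          2 * (B₁' * (α₀ + α₁)) ≤ c3 4 F.L ∧ ((4 : ℕ) : ℝ) * F.L * α₁ ≤ 1 / 8 ∧ α₀ ≤ cP ∧ α₁ ≤ cP ∧ B₁' * (α₀ + α₁) ≤ cP ∧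
          2 * (B₁' * (α₀ + α₁)) ^ 2 + 20 * ((4 : ℕ) : ℝ) * α₀ * (B₁' * (α₀ + α₁)) + 2 * C₂ * (B₁' * (α₀ + α₁)) ^ 2 ≤ α₀ + α₁) ∧
        B8.Thm4Body c₁ B₁' (fun i : {i : ZdIdx 4 F.L // (∀ j, i.Ω j = Set.univ) ∧ (∀ m j, i.Λs m j = {_y | j = m}) ∧ (∀ m j, i.Λb m j = {_c | j = m}) ∧ i.η = ((F.L : ℝ)⁻¹) ^ i.k} => (zdGF3 (Matrix (Fin N) (Fin N) ℂ) F.L β len i.1).toGFData) ∧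
        B8.Prop3Body cP 4 (F.L : ℝ) C₂ inp B₀β (fun i : {i : ZdIdx 4 F.L // (∀ j, i.Ω j = Set.univ) ∧ (∀ m j, i.Λs m j = {_y | j = m}) ∧ (∀ m j, i.Λb m j = {_c | j = m}) ∧ i.η = ((F.L : ℝ)⁻¹) ^ i.k} => (zdGF3 (Matrix (Fin N) (Fin N) ℂ) F.L β len i.1).toGFData2))
    {G : T4Family → (Site 4 → Fin 4 → (MatA N)ˣ) → Site 4 → ℕ → ℝ → ℝ → ℝ → Prop} (hGm : ∀ F, RadiiMono 4 (G F))
    (hG : ∀ (F : T4Family) (U : Site 4 → Fin 4 → (MatA N)ˣ) (x : Site 4) (K : ℕ) (α₀ α₁ α₂ : ℝ), 2 ≤ K → G F U x K α₀ α₁ α₂ →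
      ∃ (u : Site 4 → (MatA N)ˣ) (a : Site 4 → Fin 4 → MatA N),
        (∀ z, u z ∈ unitaryUnits (MatA N)) ∧
        (∀ (y : Site 4) (τ : Fin 4), l1 (y - x) ≤ 2 → ((gaugeAct u U y τ : (MatA N)ˣ) : MatA N) = exp (a y τ)) ∧
        (∀ (y : Site 4) (τ : Fin 4), l1 (y - x) ≤ 2 → ‖a y τ‖ ≤ α₀) ∧
        (∀ (y : Site 4) (τ i : Fin 4), l1 (y - x) ≤ 1 → ‖fd i (fun z => a z τ) y‖ ≤ α₁) ∧
        (∀ (τ i l : Fin 4), ‖fd i (fd l (fun z => a z τ)) x‖ ≤ α₂))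
    (C : T4Family → B11Thm1.Consts) (hM : ∀ (F : T4Family) (e : ℝ), 0 < e → e ≤ (C F).a₁ → 7 / 2 ≤ (C F).Mfun e)
    (hT : ∀ (F : T4Family) (k : ℕ), Thm1At (C F) (torusVP 4 F.L (ne3NperOfRecord₁₁ F 0 0) (G F) (k + 1))) :
    ∃ ℓ₃ : T4Family → NE3Letters₁₁, N16LettersEnd N g ℓ₃ ∧
      ∀ 𝔯 : RateReading₁₃CoPH N, N16PinnedLoose 𝔯 ℓ₃ (fun F => (C F).B₃) → N16HolderAtReading 𝔯 β := by
  choose ℓ₃ hℓ₃ using fun F => exists_letters_inEndRegimeH_leafSlotHolderAT_of_h5_thm1At (N := N) F (hg F) (h5 F) (hGm F) (hG F) (C F) (hM F) (hT F)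
  refine ⟨ℓ₃, fun F => ⟨(hℓ₃ F).1, (hℓ₃ F).2.1, (hℓ₃ F).2.2.1, (hℓ₃ F).2.2.2.1, (hℓ₃ F).2.2.2.2.1, (hℓ₃ F).2.2.2.2.2.1,
    (inEndRegimeH_loose_iff F (ℓ₃ F) _).1 (hℓ₃ F).2.2.2.2.2.2.1⟩, fun 𝔯 hpin => n16HolderAtReading_of_pinnedLoose β hpin fun F => ?_⟩
  exact n16HolderAt_of_inEndRegimeH_leafSlotHolderAT (hℓ₃ F).2.2.2.2.2.2.1 hβ0 hβ1 (hℓ₃ F).2.2.2.2.2.2.2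

end Producers

end

end Summit.QuantumFields.YangMills.BalabanUVNodes.N16PinnedLayer13CoPH
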